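import Literature.Computability.Complexity.TodaWitnessCount
import Literature.Computability.Complexity.AdaptiveQueries
import HarnessLib

/-!
# Counting guessed transcripts: the combinatorics of `PP^{PP^O} ⊆ C·C·P^O` (Torán 1991, §4)

Topic `Computability/Complexity` (counting classes). Torán's oracle characterisation of the counting
hierarchy, `Cₖ₊₁P = PP^{CₖP}` (J. Torán, *Complexity classes defined by counting quantifiers*,
J. ACM 38 (1991), §4; quoted as (3) in Bürgisser 2009, §2.1), is proved in the tree
(`CountingHierarchyOracle.lean`) from the relativised level-one inclusion
`C·(P^A) ⊆ C·C·(P^O)` for `A ∈ C·(P^O)` by **guessing, together with the oracle answers of a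
`P^A` computation, the exact witness COUNTS of its queries**. This file is the machine-free half of
that argument — pure combinatorics of bit strings, no complexity class occurs:

* fixed-width blocks: `ToranCH.blk Bw f T = natBits Bw (f 0) ⋯ natBits Bw (f (T-1))`,
  `ToranCH.blockOf Bw γ j` (the `j`-th block of width `Bw`), their values
  (`bitsToNat_blk`, `bitsToNat_eq_sum_blockOf`: a string of `T` blocks is the base-`2^{Bw}` numeral
  of its block values) and the uniqueness of base-`b` digits (`digits_unique`);
* **the uniqueness lemma** `ToranCH.cons_and_F_eq_iff`: for a query generator `Q`, an oracle
  language `A = {z | 2^{ρ z} < 2 κ z}` given by a count function `κ` (a `C·K` language: `κ z`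
  witnesses among the `2^{ρ z}` coin strings), guessed answer bits `as ∈ {0,1}^T` and guessed counts
  `γ ∈ ({0,1}^{Bw})^T`: the guess is *consistent* (`Cons`: every bit `as_j` is the threshold bit of
  the guessed count `γ_j` at the query `z_j = Q ⟨w, as ↾ j⟩`) and the aggregated true count
  `F(as) = Σ_j 2^{Bw j} κ(z_j)` equals the numeral `val γ` **iff** `as` is the true answer string
  `adBits Q A w T` (`AdaptiveQueries.lean`) and `γ` the string of true counts (`gamStar`);
* **the witness count** `ToranCH.cnt_S0set`: the coin strings `⟨1ʲ, f · c · 0…0⟩` (`j < T`, `f` free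
  of length `j·Bw`, `c` a witness of the `j`-th query) number exactly `Σ_j 2^{j Bw} · #witnesses_j`;
* **the outer count** `ToranCH.cnt_Ehat`: for the acceptance predicate `Ehat` of the outer majority
  vote (bits `d b₁ b₂`, then `y`, `as`, `γ`; branches `val γ ≤ F`, `F ≤ val γ`, "inconsistent", and
  the threshold shift), `#Ehat + 2^m = 2^{N+2} + 2·#{y | Out(y, as⋆(y))}` — so a strict majority of
  the `2^{N+3}` strings accepts iff a strict majority of the `y` does (`majority_Ehat_iff`).

Generic counting lemmas proved on the way: `cnt_prefix` (strings with a fixed prefix),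
`cnt_iUnion_of_disjoint`, `cnt_add_cnt_eq` (inclusion–exclusion), `cnt_singleton`, `cnt_lt_val`,
`cnt_eq_sum_indicator`.

## References

* J. Torán, *Complexity classes defined by counting quantifiers*, J. ACM 38 (1991) 753–774, §4
  (the oracle characterisation `Cₖ₊₁P = PP^{CₖP}`).
* P. Bürgisser, *On defining integers and proving arithmetic circuit lower bounds*, Comput.
  Complexity 18 (2009) 81–103, §2.1 (3).
* S. Arora, B. Barak, *Computational Complexity: A Modern Approach*, CUP 2009, §17.2.1 (`PP`,
  thresholds on counts), §3.4 (adaptive queries).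
-/

namespace Literature.Computability.Complexity

open _root_.Computability Finset AdQuery

namespace ToranCH

/-! ### Generic counting lemmas -/

/-- `cnt` as a sum of indicators over the strings of length `m`. [folklore] -/
theorem cnt_eq_sum_indicator (m : ℕ) (E : Set (List Bool)) [DecidablePred (· ∈ E)] :
    cnt m E = ∑ v : List.Vector Bool m, if v.toList ∈ E then 1 else 0 := by
  classical
  unfold cnt
  rw [Finset.card_filter]
  exact Finset.sum_congr rfl fun v _ => by congr 1

/-- The empty event counts zero. [folklore] -/
theorem cnt_empty' (m : ℕ) : cnt m (∅ : Set (List Bool)) = 0 := by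
  classical
  unfold cnt; simp

/-- **Strings with a fixed prefix**: among the strings of length `|u₀| + b`, those of the form
`u₀ ++ v` with `v ∈ E` are as many as the strings of length `b` in `E`. [folklore] -/
theorem cnt_prefix (u₀ : List Bool) (b : ℕ) (E : Set (List Bool)) :
    cnt (u₀.length + b) {c | ∃ v, c = u₀ ++ v ∧ v ∈ E} = cnt b E := by
  classical
  rw [TodaCount.cnt_add, Fintype.sum_eq_single (α := List.Vector Bool u₀.length) ⟨u₀, rfl⟩]
  · refine cnt_congr fun y _ => ⟨?_, fun hy => ⟨y, rfl, hy⟩⟩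
    rintro ⟨v, hv, hvE⟩
    change u₀ ++ y = u₀ ++ v at hv
    rwa [List.append_cancel_left hv]
  · intro v hv
    rw [← cnt_empty' b]
    refine cnt_congr fun y _ => ?_
    simp only [Set.mem_setOf_eq, Set.mem_empty_iff_false, iff_false, not_exists, not_and]
    intro v' h _
    apply hv
    apply List.Vector.toList_injective
    have h2 := congrArg (List.take u₀.length) h
    rw [List.take_left' v.toList_length, List.take_left' rfl] at h2
    exact h2

/-- **Inclusion–exclusion** for `cnt`. [folklore] -/
theorem cnt_add_cnt_eq (m : ℕ) (E F : Set (List Bool)) :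
    cnt m E + cnt m F = cnt m (E ∪ F) + cnt m (E ∩ F) := by
  classical
  unfold cnt
  rw [← Finset.card_union_add_card_inter]
  congr 2
  · ext r; simp
  · ext r; simp

/-- A single string of the right length counts once. [folklore] -/
theorem cnt_singleton (y : List Bool) : cnt y.length {y} = 1 := by
  classical
  unfold cnt
  rw [Finset.card_eq_one]
  refine ⟨⟨y, rfl⟩, Finset.eq_singleton_iff_unique_mem.2 ⟨by simp, fun v hv => ?_⟩⟩
  simp only [Finset.mem_filter, Finset.mem_univ, true_and, Set.mem_singleton_iff] at hv
  exact List.Vector.toList_injective (by simpa using hv)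

/-- **Numerals below a threshold**: exactly `θ` strings of length `B` have value `< θ` when
`θ ≤ 2^B`. [folklore] -/
theorem cnt_lt_val {B θ : ℕ} (h : θ ≤ 2 ^ B) : cnt B {r | bitsToNat r < θ} = θ := by
  have h1 := cnt_add_cnt_compl B {r : List Bool | θ ≤ bitsToNat r}
  rw [ThresholdPP.cnt_ge] at h1
  have h2 : ({r : List Bool | θ ≤ bitsToNat r}ᶜ : Set (List Bool)) = {r | bitsToNat r < θ} := by
    ext r; simp [not_le]
  rw [h2] at h1
  omega

/-- `cnt` of a finite disjoint union is the sum of the counts. [folklore] -/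
theorem cnt_iUnion_of_disjoint (m : ℕ) (S : ℕ → Set (List Bool)) : ∀ T : ℕ,
    (∀ i < T, ∀ j < T, i ≠ j → ∀ c, c ∈ S i → c ∉ S j) →
    cnt m {c | ∃ j < T, c ∈ S j} = ∑ j ∈ range T, cnt m (S j)
  | 0, _ => by
    rw [sum_range_zero]
    exact (cnt_congr fun c _ => by simp).trans (cnt_empty' m)
  | T + 1, hdis => by
    have ih := cnt_iUnion_of_disjoint m S T fun i hi j hj => hdis i (by omega) j (by omega)
    have hunion : {c | ∃ j < T + 1, c ∈ S j} = {c | ∃ j < T, c ∈ S j} ∪ S T := by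
      ext c
      simp only [Set.mem_setOf_eq, Set.mem_union]
      constructor
      · rintro ⟨j, hj, hc⟩
        rcases Nat.lt_succ_iff_lt_or_eq.1 hj with h | rfl
        exacts [Or.inl ⟨j, h, hc⟩, Or.inr hc]
      · rintro (⟨j, hj, hc⟩ | hc)
        exacts [⟨j, by omega, hc⟩, ⟨T, by omega, hc⟩]
    have hinter : {c | ∃ j < T, c ∈ S j} ∩ S T = ∅ := by
      ext c
      simp only [Set.mem_inter_iff, Set.mem_setOf_eq, Set.mem_empty_iff_false, iff_false, not_and]
      rintro ⟨j, hj, hc⟩ hT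
      exact hdis j (by omega) T (by omega) (by omega) c hc hT
    have h := cnt_add_cnt_eq m {c | ∃ j < T, c ∈ S j} (S T)
    rw [hinter, cnt_empty', ← hunion] at h
    rw [sum_range_succ, ← ih]
    omega

/-! ### Fixed-width blocks -/

/-- Reading back a numeral of known length (`CoinEnum.natBits_bitsToNat`). [folklore] -/
theorem natBits_bitsToNat_of_length {n : ℕ} (l : List Bool) (h : l.length = n) : natBits n (bitsToNat l) = l := by
  subst h; exact CoinEnum.natBits_bitsToNat l

/-- `blk Bw f T`: the concatenation of the width-`Bw` little-endian numerals of
`f 0, …, f (T-1)`. [folklore] -/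
def blk (Bw : ℕ) (f : ℕ → ℕ) : ℕ → List Bool
  | 0 => []
  | T + 1 => blk Bw f T ++ natBits Bw (f T)

/-- The `j`-th block of width `Bw` of a string. [folklore] -/
def blockOf (Bw : ℕ) (γ : List Bool) (j : ℕ) : List Bool := (γ.drop (j * Bw)).take Bw

/-- `blk Bw f T` has length `T · Bw`. [folklore] -/
@[simp] theorem length_blk (Bw : ℕ) (f : ℕ → ℕ) : ∀ T, (blk Bw f T).length = T * Bw
  | 0 => by simp [blk]
  | T + 1 => by rw [blk, List.length_append, length_blk Bw f T, length_natBits]; ring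

/-- The blocks of `blk`. [folklore] -/
theorem blockOf_blk (Bw : ℕ) (f : ℕ → ℕ) : ∀ {T j : ℕ}, j < T → blockOf Bw (blk Bw f T) j = natBits Bw (f j)
  | 0, _, h => absurd h (Nat.not_lt_zero _)
  | T + 1, j, h => by
    have hjT : j * Bw ≤ (blk Bw f T).length := by
      rw [length_blk]; exact Nat.mul_le_mul_right _ (Nat.le_of_lt_succ h)
    unfold blockOf
    rw [blk, List.drop_append_of_le_length hjT]
    rcases Nat.lt_or_eq_of_le (Nat.le_of_lt_succ h) with hj | rfl
    · have hlen : Bw ≤ ((blk Bw f T).drop (j * Bw)).length := by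
        rw [List.length_drop, length_blk, ← Nat.sub_mul]
        exact Nat.le_mul_of_pos_left _ (by omega)
      rw [List.take_append_of_le_length hlen]
      exact blockOf_blk Bw f hj
    · rw [List.drop_of_length_le (by rw [length_blk]), List.nil_append,
        List.take_of_length_le (by rw [length_natBits])]

/-- **Value of a block string**: `val (blk Bw f T) = Σ_{j<T} 2^{Bw j} f j` when all `f j < 2^{Bw}`. [folklore] -/
theorem bitsToNat_blk (Bw : ℕ) (f : ℕ → ℕ) :
    ∀ {T : ℕ}, (∀ j < T, f j < 2 ^ Bw) → bitsToNat (blk Bw f T) = ∑ j ∈ range T, 2 ^ (Bw * j) * f j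
  | 0, _ => by simp [blk]
  | T + 1, hf => by
    rw [blk, bitsToNat_append, bitsToNat_blk Bw f (fun j hj => hf j (Nat.lt_succ_of_lt hj)), length_blk,
      bitsToNat_natBits (hf T (Nat.lt_succ_self T)), sum_range_succ, mul_comm T Bw]

/-- The first block of a string of at least one block. [folklore] -/
theorem blockOf_zero (Bw : ℕ) (γ : List Bool) : blockOf Bw γ 0 = γ.take Bw := by
  simp [blockOf]

/-- Later blocks are the blocks of the tail past the first block. [folklore] -/
theorem blockOf_succ (Bw : ℕ) (γ : List Bool) (j : ℕ) : blockOf Bw γ (j + 1) = blockOf Bw (γ.drop Bw) j := by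
  simp only [blockOf, List.drop_drop, Nat.succ_mul]
  congr 2; ring

/-- Blocks of a full-length block string have width `Bw`. [folklore] -/
theorem length_blockOf {Bw T : ℕ} {γ : List Bool} (hγ : γ.length = T * Bw) {j : ℕ} (hj : j < T) :
    (blockOf Bw γ j).length = Bw := by
  rw [blockOf, List.length_take, List.length_drop, hγ, min_eq_left]
  rw [← Nat.sub_mul]
  exact Nat.le_mul_of_pos_left _ (by omega)

/-- **Base-`2^{Bw}` expansion of a block string**: `val γ = Σ_{j<T} 2^{Bw j} val(γ_j)` for
`|γ| = T · Bw`. [folklore] -/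
theorem bitsToNat_eq_sum_blockOf (Bw : ℕ) : ∀ (T : ℕ) (γ : List Bool), γ.length = T * Bw →
    bitsToNat γ = ∑ j ∈ range T, 2 ^ (Bw * j) * bitsToNat (blockOf Bw γ j)
  | 0, γ, h => by
    rw [Nat.zero_mul, List.length_eq_zero_iff] at h
    subst h; simp
  | T + 1, γ, h => by
    have hlen : (γ.drop Bw).length = T * Bw := by rw [List.length_drop, h]; rw [Nat.succ_mul]; omega
    conv_lhs => rw [← List.take_append_drop Bw γ]
    rw [bitsToNat_append, List.length_take, min_eq_left (by rw [h, Nat.succ_mul]; omega),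
      bitsToNat_eq_sum_blockOf Bw T _ hlen, sum_range_succ', blockOf_zero, Nat.mul_zero, pow_zero, one_mul,
      add_comm, mul_sum]
    congr 1
    refine sum_congr rfl fun j _ => ?_
    rw [blockOf_succ, ← mul_assoc, ← pow_add]
    congr 2
    ring

/-- **A block string is determined by its block values**: `γ = blk Bw (val ∘ γ_·) T`. [folklore] -/
theorem eq_blk_blockOf (Bw : ℕ) : ∀ (T : ℕ) (γ : List Bool), γ.length = T * Bw →
    γ = blk Bw (fun j => bitsToNat (blockOf Bw γ j)) T
  | 0, γ, h => by
    rw [Nat.zero_mul, List.length_eq_zero_iff] at h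
    subst h; rfl
  | T + 1, γ, h => by
    have hT : T * Bw ≤ γ.length := by rw [h, Nat.succ_mul]; omega
    have hlen : (γ.take (T * Bw)).length = T * Bw := by rw [List.length_take, min_eq_left hT]
    have hblocks : ∀ j < T, blockOf Bw (γ.take (T * Bw)) j = blockOf Bw γ j := fun j hj => by
      unfold blockOf
      rw [List.drop_take, List.take_take, min_eq_left]
      rw [← Nat.sub_mul]
      exact Nat.le_mul_of_pos_left _ (by omega)
    have hlast : blockOf Bw γ T = γ.drop (T * Bw) := by
      rw [blockOf, List.take_of_length_le]
      rw [List.length_drop, h, Nat.succ_mul]; omega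
    rw [blk]
    conv_lhs => rw [← List.take_append_drop (T * Bw) γ, eq_blk_blockOf Bw T _ hlen]
    congr 1
    · clear hlast
      -- the two block-value functions agree below `T`
      suffices hh : ∀ T' ≤ T, blk Bw (fun j => bitsToNat (blockOf Bw (γ.take (T * Bw)) j)) T' =
          blk Bw (fun j => bitsToNat (blockOf Bw γ j)) T' from hh T le_rfl
      intro T' hT'
      induction T' with
      | zero => rfl
      | succ T' ih => rw [blk, blk, ih (Nat.le_of_succ_le hT'), hblocks T' hT']
    · have hl : (γ.drop (T * Bw)).length = Bw := by rw [List.length_drop, h, Nat.succ_mul]; omega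
      rw [hlast, natBits_bitsToNat_of_length _ hl]

/-- **Uniqueness of base-`b` digits** below `T` places. [folklore] -/
theorem digits_unique {b : ℕ} (hb : 0 < b) : ∀ (T : ℕ) (f g : ℕ → ℕ), (∀ j < T, f j < b) → (∀ j < T, g j < b) →
    ∑ j ∈ range T, b ^ j * f j = ∑ j ∈ range T, b ^ j * g j → ∀ j < T, f j = g j
  | 0, _, _, _, _, _, j, hj => absurd hj (Nat.not_lt_zero _)
  | T + 1, f, g, hf, hg, h, j, hj => by
    rw [sum_range_succ', sum_range_succ'] at h
    simp only [pow_zero, one_mul, pow_succ] at h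
    have hsplit : ∀ (u : ℕ → ℕ), ∑ j ∈ range T, b ^ j * b * u (j + 1) = b * ∑ j ∈ range T, b ^ j * u (j + 1) :=
      fun u => by rw [mul_sum]; exact sum_congr rfl fun j _ => by ring
    rw [hsplit f, hsplit g] at h
    have h0 : f 0 = g 0 := by
      have := congrArg (· % b) h
      simpa [Nat.mul_add_mod, Nat.mod_eq_of_lt (hf 0 (Nat.zero_lt_succ _)),
        Nat.mod_eq_of_lt (hg 0 (Nat.zero_lt_succ _)), add_comm] using this
    rcases j with _ | j
    · exact h0
    · have h' : ∑ j ∈ range T, b ^ j * f (j + 1) = ∑ j ∈ range T, b ^ j * g (j + 1) := by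
        rw [h0] at h
        exact Nat.eq_of_mul_eq_mul_left hb (Nat.add_right_cancel h)
      exact digits_unique hb T (fun j => f (j + 1)) (fun j => g (j + 1)) (fun j hj => hf (j + 1) (by omega))
        (fun j hj => hg (j + 1) (by omega)) h' j (by omega)

/-! ### Guessed transcripts with guessed counts -/

section Guess

variable (Q : List Bool → List Bool) (A : Language Bool) (ρ κ : List Bool → ℕ) (w : List Bool) (T Bw : ℕ)

/-- The `j`-th query along the guessed answers `as`: `Q ⟨w, as ↾ j⟩`. [Arora–Barak 2009, §3.4] [folklore] -/
def qry (as : List Bool) (j : ℕ) : List Bool := Q (boolPair w (as.take j))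

/-- **Consistency of a guess**: every guessed answer bit `as_j` (`j < T`) is the threshold bit
`[2^{ρ z_j} < 2·val γ_j]` of the guessed count `γ_j` (block `j` of `γ`) at the query `z_j`.
[cite: Toran1991, §4] -/
def Cons (as γ : List Bool) : Prop :=
  ∀ j < T, as.getD j false = decide (2 ^ ρ (qry Q w as j) < 2 * bitsToNat (blockOf Bw γ j))

/-- **The aggregated true count along a guess**: `F(as) = Σ_{j<T} 2^{Bw j} κ(z_j)`. [cite: Toran1991, §4] -/
noncomputable def Fval (as : List Bool) : ℕ := ∑ j ∈ range T, 2 ^ (Bw * j) * κ (qry Q w as j)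

/-- The string of true counts along the true answers `adBits Q A w T`. [cite: Toran1991, §4] -/
noncomputable def gamStar : List Bool := blk Bw (fun j => κ (qry Q w (adBits Q A w T) j)) T

variable {Q A ρ κ w T Bw}

/-- `qry` only reads `as ↾ j`. [folklore] -/
theorem qry_eq_of_take_eq {as as' : List Bool} {j : ℕ} (h : as.take j = as'.take j) :
    qry Q w as j = qry Q w as' j := by
  rw [qry, qry, h]

/-- The answer bits of `adBits` one at a time. [folklore] -/
theorem adBits_getD {i T : ℕ} (hi : i < T) :
    (adBits Q A w T).getD i false = A.boolIndicator (Q (boolPair w (adBits Q A w i))) := by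
  have h1 : (adBits Q A w T).getD i false = ((adBits Q A w T).take (i + 1)).getD i false := by
    rw [List.getD_eq_getElem?_getD, List.getD_eq_getElem?_getD, List.getElem?_take, if_pos (Nat.lt_succ_self i)]
  rw [h1, adBits_take A w (Nat.succ_le_of_lt hi), adBits_succ, List.getD_eq_getElem?_getD,
    List.getElem?_append_right (by rw [length_adBits]), length_adBits, Nat.sub_self, List.getElem?_cons_zero,
    Option.getD_some]

/-- `gamStar` has `T` blocks. [folklore] -/
@[simp] theorem length_gamStar : (gamStar Q A κ w T Bw).length = T * Bw := length_blk _ _ _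

/-- **The uniqueness lemma.** For `A = {z | 2^{ρ z} < 2 κ z}` and counts bounded by `2^{Bw}` along
every guess, a guess `(as, γ)` of the right lengths is consistent with `F(as) = val γ` iff it is
the true transcript with the true counts. [cite: Toran1991, §4] -/
theorem cons_and_F_eq_iff (hA : ∀ z, z ∈ A ↔ 2 ^ ρ z < 2 * κ z)
    (hκ : ∀ (as : List Bool) (j : ℕ), j < T → κ (qry Q w as j) < 2 ^ Bw)
    {as γ : List Bool} (has : as.length = T) (hγ : γ.length = T * Bw) :
    (Cons Q ρ w T Bw as γ ∧ Fval Q κ w T Bw as = bitsToNat γ) ↔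
      (as = adBits Q A w T ∧ γ = gamStar Q A κ w T Bw) := by
  have hBw : 0 < 2 ^ Bw := Nat.two_pow_pos Bw
  have hind : ∀ z, A.boolIndicator z = decide (2 ^ ρ z < 2 * κ z) := fun z => by
    by_cases hz : z ∈ A
    · rw [(Set.mem_iff_boolIndicator _ _).1 hz, eq_comm, decide_eq_true_eq]; exact (hA z).1 hz
    · rw [(Set.notMem_iff_boolIndicator _ _).1 hz, eq_comm, decide_eq_false_iff_not]; exact fun h => hz ((hA z).2 h)
  constructor
  · rintro ⟨hcons, hF⟩
    -- digit by digit: the guessed counts are the true counts along `as`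
    have hdig : ∀ j < T, κ (qry Q w as j) = bitsToNat (blockOf Bw γ j) := by
      have hsum : ∑ j ∈ range T, (2 ^ Bw) ^ j * κ (qry Q w as j) =
          ∑ j ∈ range T, (2 ^ Bw) ^ j * bitsToNat (blockOf Bw γ j) := by
        have h1 := hF
        rw [Fval, bitsToNat_eq_sum_blockOf Bw T γ hγ] at h1
        simpa only [← pow_mul] using h1
      exact digits_unique hBw T _ _ (fun j hj => hκ as j hj)
        (fun j hj => by
          have := bitsToNat_lt (blockOf Bw γ j)
          rwa [length_blockOf hγ hj] at this) hsum
    -- round induction: the guessed answers are the true answers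
    have htake : ∀ i ≤ T, as.take i = adBits Q A w i := by
      intro i hi
      induction i with
      | zero => rfl
      | succ i ih =>
        have hi' : i < T := Nat.lt_of_succ_le hi
        have hq : qry Q w as i = Q (boolPair w (adBits Q A w i)) := by rw [qry, ih hi'.le]
        rw [PRelSigma.take_succ_eq_getD as (by rw [has]; exact hi'), ih hi'.le, adBits_succ, hcons i hi', ← hdig i hi',
          hind, hq]
    have hasEq : as = adBits Q A w T := by rw [← htake T le_rfl, ← has, List.take_length]
    refine ⟨hasEq, ?_⟩
    rw [eq_blk_blockOf Bw T γ hγ, gamStar]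
    -- equal block values give equal block strings
    suffices h : ∀ T' ≤ T, blk Bw (fun j => bitsToNat (blockOf Bw γ j)) T' =
        blk Bw (fun j => κ (qry Q w (adBits Q A w T) j)) T' from h T le_rfl
    intro T' hT'
    induction T' with
    | zero => rfl
    | succ T' ih => rw [blk, blk, ih (Nat.le_of_succ_le hT'), ← hdig T' hT', hasEq]
  · rintro ⟨rfl, rfl⟩
    have hblk : ∀ j < T, bitsToNat (blockOf Bw (gamStar Q A κ w T Bw) j) = κ (qry Q w (adBits Q A w T) j) :=
      fun j hj => by rw [gamStar, blockOf_blk Bw _ hj, bitsToNat_natBits (hκ _ j hj)]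
    refine ⟨fun j hj => ?_, ?_⟩
    · have hq : qry Q w (adBits Q A w T) j = Q (boolPair w (adBits Q A w j)) := by
        rw [qry, adBits_take A w hj.le]
      rw [hblk j hj, adBits_getD hj, hind, hq]
    · rw [gamStar, bitsToNat_blk Bw _ (fun j hj => hκ _ j hj), Fval]

end Guess

/-! ### Counting the coin strings `⟨1ʲ, f · c · 0…0⟩` -/

section WitnessCount

variable (T Bw : ℕ) (ρj : ℕ → ℕ) (Dj : ℕ → Set (List Bool))

/-- The witness set of the aggregated count: strings `⟨1ʲ, rest⟩` with `j < T`,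
`rest = f · c · 0…0`, `|f| = j·Bw` free, `|c| = ρ_j`, `c ∈ D_j`. [cite: Toran1991, §4] -/
def S0set : Set (List Bool) :=
  {c | ∃ j < T, ∃ rest, c = boolPair (List.replicate j true) rest ∧
    true ∉ rest.drop (j * Bw + ρj j) ∧ (rest.drop (j * Bw)).take (ρj j) ∈ Dj j}

variable {T Bw ρj Dj}

/-- The rest strings of one level `j`: free prefix of length `j·Bw`, witness, zero padding.
[folklore] -/
theorem cnt_rest (j e : ℕ) :
    cnt (j * Bw + (ρj j + e)) {rest | true ∉ rest.drop (j * Bw + ρj j) ∧ (rest.drop (j * Bw)).take (ρj j) ∈ Dj j} =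
      2 ^ (j * Bw) * cnt (ρj j) (Dj j) := by
  have hset : {rest : List Bool | true ∉ rest.drop (j * Bw + ρj j) ∧ (rest.drop (j * Bw)).take (ρj j) ∈ Dj j} =
      {rest | rest.take (j * Bw) ∈ (Set.univ : Set (List Bool)) ∧ rest.drop (j * Bw) ∈
        {s | s.take (ρj j) ∈ Dj j ∧ s.drop (ρj j) = List.replicate (s.length - ρj j) false}} := by
    ext rest
    simp only [Set.mem_setOf_eq, Set.mem_univ, true_and, List.drop_drop, List.length_drop]
    rw [ThresholdPP.true_not_mem_iff, List.length_drop, and_comm]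
    constructor
    · rintro ⟨h1, h2⟩; refine ⟨h1, ?_⟩; rw [h2]; congr 1; omega
    · rintro ⟨h1, h2⟩; refine ⟨h1, ?_⟩; rw [h2]; congr 1; omega
  rw [hset, cnt_take_drop, cnt_univ, ThresholdPP.cnt_take_mem_of_drop_zero _ (Nat.le_add_right _ _)]

/-- **The witness count**: for `n ≥ 2T + T·Bw + R` and `ρ_j ≤ R`,
`#(S0set ∩ {0,1}ⁿ) = Σ_{j<T} 2^{j·Bw} · #D_j`. [cite: Toran1991, §4] -/
theorem cnt_S0set {n R : ℕ} (hn : 2 * T + T * Bw + R ≤ n) (hρ : ∀ j < T, ρj j ≤ R) :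
    cnt n (S0set T Bw ρj Dj) = ∑ j ∈ range T, 2 ^ (j * Bw) * cnt (ρj j) (Dj j) := by
  set P : ℕ → Set (List Bool) := fun j =>
    {rest | true ∉ rest.drop (j * Bw + ρj j) ∧ (rest.drop (j * Bw)).take (ρj j) ∈ Dj j} with hP
  have hS : S0set T Bw ρj Dj = {c | ∃ j < T, c ∈ {c | ∃ rest, c = boolPair (List.replicate j true) rest ∧ rest ∈ P j}} := by
    ext c; simp only [S0set, hP, Set.mem_setOf_eq]
  have hdis : ∀ i < T, ∀ j < T, i ≠ j → ∀ c : List Bool,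
      c ∈ {c : List Bool | ∃ rest, c = boolPair (List.replicate i true) rest ∧ rest ∈ P i} →
      c ∉ {c : List Bool | ∃ rest, c = boolPair (List.replicate j true) rest ∧ rest ∈ P j} := by
    intro i _ j _ hij c hi hj
    obtain ⟨rest, rfl, -⟩ := hi
    obtain ⟨rest', h', -⟩ := hj
    have hh := boolPair_injective (a₁ := (List.replicate i true, rest)) (a₂ := (List.replicate j true, rest')) h'
    obtain ⟨h1, -⟩ := Prod.mk.inj hh
    exact hij (List.replicate_inj.1 h1).1
  rw [hS, cnt_iUnion_of_disjoint n _ T hdis]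
  refine sum_congr rfl fun j hj => ?_
  have hj' := mem_range.1 hj
  -- length bookkeeping: `n = (2j + 2) + (j·Bw + (ρ_j + e))`
  have hjT : j * Bw ≤ T * Bw := Nat.mul_le_mul_right _ hj'.le
  set u₀ : List Bool := boolPair (List.replicate j true) [] with hu₀
  have hlen₀ : u₀.length = 2 * j + 2 := by
    rw [hu₀, length_boolPair, List.length_replicate, List.length_nil, add_zero]
  obtain ⟨e, he⟩ : ∃ e, n = u₀.length + (j * Bw + (ρj j + e)) := by
    refine ⟨n - (2 * j + 2) - j * Bw - ρj j, ?_⟩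
    rw [hlen₀]
    have := hρ j hj'
    omega
  have hform : ∀ rest : List Bool, boolPair (List.replicate j true) rest = u₀ ++ rest := fun rest => by
    rw [hu₀, boolPair, boolPair, List.append_nil, List.append_assoc]
  have hset : {c : List Bool | ∃ rest, c = boolPair (List.replicate j true) rest ∧ rest ∈ P j} =
      {c | ∃ v, c = u₀ ++ v ∧ v ∈ P j} := by
    ext c
    simp only [Set.mem_setOf_eq, hform]
  rw [he, hset, cnt_prefix, hP]
  exact cnt_rest j e

end WitnessCount

/-! ### The outer count -/

section Outer

variable (m T Bw : ℕ) (ConsP : List Bool → List Bool → List Bool → Prop) (OutP : List Bool → List Bool → Prop)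
  (Fv : List Bool → List Bool → ℕ)

/-- The acceptance condition of the outer vote on the components `d b₁ b₂ y as γ`: branch
`val γ ≤ F` (`d = 0, b₁ = 0`, consistent and accepting), branch `F ≤ val γ` (`d = 0, b₁ = 1`,
consistent and accepting), the inconsistent-or-rejecting strings (`d = 0`, accepted iff `b₁ = 1`),
and the threshold shift (`d = 1`: accepted iff `b₁ = 0` unless `b₂ = 0` and `as γ ∈ 0*`).
[cite: Toran1991, §4] -/
def Phi (d b₁ b₂ : Bool) (y as γ : List Bool) : Prop :=
  (d = false ∧ ((b₁ = false ∧ (ConsP y as γ ∧ OutP y as) ∧ bitsToNat γ ≤ Fv y as) ∨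
    (b₁ = true ∧ (ConsP y as γ ∧ OutP y as) ∧ Fv y as ≤ bitsToNat γ) ∨
    (b₁ = true ∧ ¬ (ConsP y as γ ∧ OutP y as)))) ∨
  (d = true ∧ b₁ = false ∧ ¬ (b₂ = false ∧ true ∉ as ++ γ))

/-- **The outer event** on strings `d b₁ b₂ · y · as · γ` (`|y| = m`, `|as| = T`, the rest is `γ`).
[cite: Toran1991, §4] -/
def Ehat : Set (List Bool) :=
  {u | ∃ d b₁ b₂ rest, u = d :: b₁ :: b₂ :: rest ∧
    Phi ConsP OutP Fv d b₁ b₂ (rest.take m) ((rest.drop m).take T) (rest.drop (m + T))}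

variable {m T Bw ConsP OutP Fv}

/-- Reading `Ehat` on a string with its three leading bits exposed. [folklore] -/
theorem cons_mem_Ehat_iff (d b₁ b₂ : Bool) (rest : List Bool) :
    d :: b₁ :: b₂ :: rest ∈ Ehat m T ConsP OutP Fv ↔
      Phi ConsP OutP Fv d b₁ b₂ (rest.take m) ((rest.drop m).take T) (rest.drop (m + T)) := by
  constructor
  · rintro ⟨d', b₁', b₂', rest', h, hΦ⟩
    simp only [List.cons.injEq] at h
    obtain ⟨rfl, rfl, rfl, rfl⟩ := h
    exact hΦ
  · intro h; exact ⟨d, b₁, b₂, rest, rfl, h⟩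

/-- The `d = 1` half: `2^N + (2^N − 2^m)` accepted strings. [folklore] -/
theorem cnt_Ehat_true (N : ℕ) (hm : m ≤ N) :
    cnt N {y | false :: y ∈ {y | false :: y ∈ {y | true :: y ∈ Ehat m T ConsP OutP Fv}}} +
      cnt N {y | true :: y ∈ {y | false :: y ∈ {y | true :: y ∈ Ehat m T ConsP OutP Fv}}} +
      (cnt N {y | false :: y ∈ {y | true :: y ∈ {y | true :: y ∈ Ehat m T ConsP OutP Fv}}} +
      cnt N {y | true :: y ∈ {y | true :: y ∈ {y | true :: y ∈ Ehat m T ConsP OutP Fv}}}) + 2 ^ m =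
      2 ^ N + 2 ^ N := by
  have hread : ∀ (b₁ b₂ : Bool) (rest : List Bool),
      (rest ∈ {y : List Bool | b₂ :: y ∈ {y : List Bool | b₁ :: y ∈ {y | true :: y ∈ Ehat m T ConsP OutP Fv}}}) ↔
        (b₁ = false ∧ ¬ (b₂ = false ∧ true ∉ rest.drop m)) := by
    intro b₁ b₂ rest
    change true :: b₁ :: b₂ :: rest ∈ Ehat m T ConsP OutP Fv ↔ _
    rw [cons_mem_Ehat_iff, Phi]
    have happ : (rest.drop m).take T ++ rest.drop (m + T) = rest.drop m := by
      rw [← List.drop_drop, List.take_append_drop]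
    simp [happ]
  have h00 : cnt N {y | false :: y ∈ {y | false :: y ∈ {y | true :: y ∈ Ehat m T ConsP OutP Fv}}} + 2 ^ m = 2 ^ N := by
    have hz : cnt N {rest : List Bool | true ∉ rest.drop m} = 2 ^ m := by
      obtain ⟨e, rfl⟩ := Nat.exists_eq_add_of_le hm
      rw [show {rest : List Bool | true ∉ rest.drop m} = {rest | rest.take m ∈ (Set.univ : Set (List Bool)) ∧
          rest.drop m ∈ {s : List Bool | true ∉ s}} by ext; simp, cnt_take_drop, cnt_univ, PPSharpP.cnt_noTrue, mul_one]
    have hc := cnt_add_cnt_compl N {rest : List Bool | true ∉ rest.drop m}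
    rw [hz, add_comm] at hc
    rw [← hc]
    congr 1
    exact cnt_congr fun rest _ => by rw [hread]; simp
  have h10 : cnt N {y | true :: y ∈ {y | false :: y ∈ {y | true :: y ∈ Ehat m T ConsP OutP Fv}}} = 2 ^ N :=
    cnt_eq_two_pow_of_forall fun rest _ => by rw [hread]; simp
  have h01 : cnt N {y | false :: y ∈ {y | true :: y ∈ {y | true :: y ∈ Ehat m T ConsP OutP Fv}}} = 0 := by
    rw [← cnt_empty' N]; exact cnt_congr fun rest _ => by rw [hread]; simp
  have h11 : cnt N {y | true :: y ∈ {y | true :: y ∈ {y | true :: y ∈ Ehat m T ConsP OutP Fv}}} = 0 := by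
    rw [← cnt_empty' N]; exact cnt_congr fun rest _ => by rw [hread]; simp
  omega

variable (asS gaS : List Bool → List Bool)

/-- The consistent accepting guesses with `F = val γ` over the strings `y · s`: one per accepting
`y` (the uniqueness hypothesis `HU`). [cite: Toran1991, §4] -/
theorem cnt_CO_eq (hasS : ∀ y, (asS y).length = T) (hgaS : ∀ y, (gaS y).length = T * Bw)
    (HU : ∀ y as γ : List Bool, y.length = m → as.length = T → γ.length = T * Bw →
      ((ConsP y as γ ∧ Fv y as = bitsToNat γ) ↔ (as = asS y ∧ γ = gaS y))) :
    cnt (m + (T + T * Bw)) {rest | (ConsP (rest.take m) ((rest.drop m).take T) (rest.drop (m + T)) ∧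
        OutP (rest.take m) ((rest.drop m).take T)) ∧
        Fv (rest.take m) ((rest.drop m).take T) = bitsToNat (rest.drop (m + T))} =
      cnt m {y | OutP y (asS y)} := by
  classical
  rw [TodaCount.cnt_add, cnt_eq_sum_indicator m]
  refine sum_congr rfl fun v _ => ?_
  have hv : v.toList.length = m := v.toList_length
  have hset : ∀ s : List Bool, s.length = T + T * Bw →
      ((v.toList ++ s) ∈ {rest : List Bool | (ConsP (rest.take m) ((rest.drop m).take T) (rest.drop (m + T)) ∧
        OutP (rest.take m) ((rest.drop m).take T)) ∧
        Fv (rest.take m) ((rest.drop m).take T) = bitsToNat (rest.drop (m + T))} ↔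
        (OutP v.toList (asS v.toList) ∧ s = asS v.toList ++ gaS v.toList)) := by
    intro s hs
    simp only [Set.mem_setOf_eq]
    rw [← List.drop_drop, List.take_append_of_le_length hv.ge, List.take_of_length_le hv.le,
      List.drop_append_of_le_length hv.ge, List.drop_of_length_le hv.le, List.nil_append]
    have h1 : (s.take T).length = T := by rw [List.length_take, hs]; omega
    have h2 : (s.drop T).length = T * Bw := by rw [List.length_drop, hs]; omega
    have hU := HU v.toList (s.take T) (s.drop T) hv h1 h2
    constructor
    · rintro ⟨⟨hc, ho⟩, hF⟩
      obtain ⟨ha, hg⟩ := hU.1 ⟨hc, hF⟩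
      refine ⟨ha ▸ ho, ?_⟩
      rw [← List.take_append_drop T s, ha, hg]
    · rintro ⟨ho, rfl⟩
      have ht : (asS v.toList ++ gaS v.toList).take T = asS v.toList := by
        rw [List.take_append_of_le_length (hasS _).ge, List.take_of_length_le (hasS _).le]
      have hd : (asS v.toList ++ gaS v.toList).drop T = gaS v.toList := by
        rw [List.drop_append_of_le_length (hasS _).ge, List.drop_of_length_le (hasS _).le, List.nil_append]
      rw [ht, hd] at hU ⊢
      obtain ⟨hc, hF⟩ := hU.2 ⟨rfl, rfl⟩
      exact ⟨⟨hc, ho⟩, hF⟩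
  by_cases ho : OutP v.toList (asS v.toList)
  · rw [if_pos (show v.toList ∈ {y | OutP y (asS y)} from ho)]
    have hlen : (asS v.toList ++ gaS v.toList).length = T + T * Bw := by
      rw [List.length_append, hasS, hgaS]
    rw [← cnt_singleton (asS v.toList ++ gaS v.toList), hlen]
    exact cnt_congr fun s hs => by rw [Set.mem_setOf_eq, hset s hs]; simp [ho]
  · rw [if_neg (show v.toList ∉ {y | OutP y (asS y)} from ho), ← cnt_empty' (T + T * Bw)]
    exact cnt_congr fun s hs => by rw [Set.mem_setOf_eq, hset s hs]; simp [ho]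

/-- The `d = 0` half (one value of `b₂`): `2^N + #{y | Out(y, as⋆ y)}` accepted strings over the two
values of `b₁`. [cite: Toran1991, §4] -/
theorem cnt_Ehat_false (b₂ : Bool) (hasS : ∀ y, (asS y).length = T) (hgaS : ∀ y, (gaS y).length = T * Bw)
    (HU : ∀ y as γ : List Bool, y.length = m → as.length = T → γ.length = T * Bw →
      ((ConsP y as γ ∧ Fv y as = bitsToNat γ) ↔ (as = asS y ∧ γ = gaS y))) :
    cnt (m + (T + T * Bw)) {rest | b₂ :: rest ∈ {r | false :: r ∈ {r | false :: r ∈ Ehat m T ConsP OutP Fv}}} +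
      cnt (m + (T + T * Bw)) {rest | b₂ :: rest ∈ {r | true :: r ∈ {r | false :: r ∈ Ehat m T ConsP OutP Fv}}} =
      2 ^ (m + (T + T * Bw)) + cnt m {y | OutP y (asS y)} := by
  set N := m + (T + T * Bw)
  -- abbreviations for the components of `rest`
  set CO : List Bool → Prop := fun rest => ConsP (rest.take m) ((rest.drop m).take T) (rest.drop (m + T)) ∧
    OutP (rest.take m) ((rest.drop m).take T) with hCO
  set F : List Bool → ℕ := fun rest => Fv (rest.take m) ((rest.drop m).take T) with hF
  set G : List Bool → ℕ := fun rest => bitsToNat (rest.drop (m + T)) with hG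
  have hX₁ : {rest : List Bool | b₂ :: rest ∈ {r : List Bool | false :: r ∈ {r | false :: r ∈ Ehat m T ConsP OutP Fv}}} =
      {rest | CO rest ∧ G rest ≤ F rest} := by
    ext rest
    change false :: false :: b₂ :: rest ∈ Ehat m T ConsP OutP Fv ↔ _
    rw [cons_mem_Ehat_iff, Phi]; simp [hCO, hF, hG]
  have hX₂ : {rest : List Bool | b₂ :: rest ∈ {r : List Bool | true :: r ∈ {r | false :: r ∈ Ehat m T ConsP OutP Fv}}} =
      {rest | (CO rest ∧ F rest ≤ G rest) ∨ ¬ CO rest} := by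
    ext rest
    change false :: true :: b₂ :: rest ∈ Ehat m T ConsP OutP Fv ↔ _
    rw [cons_mem_Ehat_iff, Phi]; simp [hCO, hF, hG]
  rw [hX₁, hX₂, cnt_add_cnt_eq]
  have hunion : ({rest : List Bool | CO rest ∧ G rest ≤ F rest} ∪ {rest | (CO rest ∧ F rest ≤ G rest) ∨ ¬ CO rest}) =
      Set.univ := by
    ext rest
    simp only [Set.mem_union, Set.mem_setOf_eq, Set.mem_univ, iff_true]
    by_cases hc : CO rest
    · rcases le_total (G rest) (F rest) with h | h
      · exact Or.inl ⟨hc, h⟩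
      · exact Or.inr (Or.inl ⟨hc, h⟩)
    · exact Or.inr (Or.inr hc)
  have hinter : ({rest : List Bool | CO rest ∧ G rest ≤ F rest} ∩ {rest | (CO rest ∧ F rest ≤ G rest) ∨ ¬ CO rest}) =
      {rest | CO rest ∧ F rest = G rest} := by
    ext rest
    simp only [Set.mem_inter_iff, Set.mem_setOf_eq]
    constructor
    · rintro ⟨⟨hc, h1⟩, h2⟩
      rcases h2 with ⟨-, h2⟩ | h2
      · exact ⟨hc, le_antisymm h2 h1⟩
      · exact absurd hc h2
    · rintro ⟨hc, h⟩
      exact ⟨⟨hc, h.ge⟩, Or.inl ⟨hc, h.le⟩⟩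
  rw [hunion, hinter, cnt_univ]
  congr 1
  exact cnt_CO_eq asS gaS hasS hgaS HU

/-- **The outer count.** Under the uniqueness hypothesis `HU` (exactly the true guess is consistent
with `F = val γ`), `#Ehat + 2^m = 2^{N+2} + 2·#{y | Out(y, as⋆ y)}` where `N = m + T + T·Bw`.
[cite: Toran1991, §4] -/
theorem cnt_Ehat (hasS : ∀ y, (asS y).length = T) (hgaS : ∀ y, (gaS y).length = T * Bw)
    (HU : ∀ y as γ : List Bool, y.length = m → as.length = T → γ.length = T * Bw →
      ((ConsP y as γ ∧ Fv y as = bitsToNat γ) ↔ (as = asS y ∧ γ = gaS y))) :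
    cnt (m + (T + T * Bw) + 3) (Ehat m T ConsP OutP Fv) + 2 ^ m =
      2 ^ (m + (T + T * Bw) + 2) + 2 * cnt m {y | OutP y (asS y)} := by
  rw [show m + (T + T * Bw) + 3 = m + (T + T * Bw) + 1 + 1 + 1 from rfl, cnt_succ, cnt_succ, cnt_succ, cnt_succ,
    cnt_succ, cnt_succ, cnt_succ]
  have hf0 := cnt_Ehat_false (ConsP := ConsP) (OutP := OutP) (Fv := Fv) (m := m) (T := T) (Bw := Bw) asS gaS false
    hasS hgaS HU
  have hf1 := cnt_Ehat_false (ConsP := ConsP) (OutP := OutP) (Fv := Fv) (m := m) (T := T) (Bw := Bw) asS gaS true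
    hasS hgaS HU
  have ht := cnt_Ehat_true (ConsP := ConsP) (OutP := OutP) (Fv := Fv) (m := m) (T := T) (m + (T + T * Bw)) (by omega)
  have h2 : (2 : ℕ) ^ (m + (T + T * Bw) + 2) = 2 ^ (m + (T + T * Bw)) + 2 ^ (m + (T + T * Bw)) +
      (2 ^ (m + (T + T * Bw)) + 2 ^ (m + (T + T * Bw))) := by ring
  omega

/-- **The outer majority**: a strict majority of the `2^{N+3}` strings is accepted iff a strict
majority of the `y ∈ {0,1}^m` has `Out(y, as⋆ y)`. [cite: Toran1991, §4] -/
theorem majority_Ehat_iff (hasS : ∀ y, (asS y).length = T) (hgaS : ∀ y, (gaS y).length = T * Bw)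
    (HU : ∀ y as γ : List Bool, y.length = m → as.length = T → γ.length = T * Bw →
      ((ConsP y as γ ∧ Fv y as = bitsToNat γ) ↔ (as = asS y ∧ γ = gaS y))) :
    2 ^ (m + (T + T * Bw) + 3) < 2 * cnt (m + (T + T * Bw) + 3) (Ehat m T ConsP OutP Fv) ↔
      2 ^ m < 2 * cnt m {y | OutP y (asS y)} := by
  have h := cnt_Ehat asS gaS hasS hgaS HU (ConsP := ConsP) (OutP := OutP) (Fv := Fv)
  have hmN : 2 ^ m ≤ 2 ^ (m + (T + T * Bw) + 2) := Nat.pow_le_pow_right two_pos (by omega)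
  rw [pow_succ]
  omega

end Outer

end ToranCH

end Literature.Computability.Complexity
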